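import Summits.AtomisticToContinuum.Crystallization.Theorems.ChessboardParticlePlanesPeriodicWindowsGapSqueezeCompetitor1

/-!
# Crux `PeriodicWindows` (stmt-AtomisticToContinuum-3240), line `dense-laminar-hull` — symmetries of the general-offset layer
# interaction (ROADMAP step 6 of the registry engine of P3b2′; lead c11)

The interaction of a point with a full triangular layer at height `H` and horizontal offset `θ`,
`Φ(a, H, θ) = Σ'_{(i,j) ∈ ℤ²} V ‖i v₁(a) + j v₂(a) + θ + H e₃‖` (written inline; no definition is introduced), is

* invariant under lattice translations of the offset, `θ ↦ θ + i₀ v₁ + j₀ v₂` (`gs_offsetLayer_translate`);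
* invariant under the rotation by `2π/3` about the HOLLOW site `b = (v₁ + v₂)/3`, `θ ↦ T(θ - b) + b`, for every norm-preserving
  additive map `T` with `T v₁ = v₂ - v₁`, `T v₂ = -v₁`, `T e₃ = e₃` (`gs_offsetLayer_rotate_hollow`): the substitution
  `(i, j) ↦ (j, -i - j - 1)` of `ℤ²` (`T⁻¹ (i v₁ + j v₂ + b) - b = j v₁ + (-i-j-1) v₂`).

Both are re-indexings of the `tsum` by an equivalence of `ℤ²` (`Equiv.tsum_eq`), valid for every potential `V` and without any
summability. Consequence used by the registry engine: `Φ(a,H,·)` has a critical point at every hollow site (its gradient there is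
invariant under a rotation by `2π/3`, hence zero) — the differentiability is not treated here. [folklore]
-/

noncomputable section

namespace Summit.AtomisticToContinuum.Crystallization.Theorems.PeriodicWindowsDenseLaminarHull

open Literature.MathematicalPhysics.StatisticalMechanics Filter Metric
open scoped BigOperators

/-- **Translation invariance of the layer interaction in the offset**: shifting the offset by a lattice vector
`i₀ v₁ + j₀ v₂` re-indexes the lattice sum. [folklore] -/
theorem gs_offsetLayer_translate (V : ℝ → ℝ) (a H : ℝ) (θ : EuclideanSpace ℝ (Fin 3)) (i₀ j₀ : ℤ) :
    (∑' ij : ℤ × ℤ, V ‖((ij.1 : ℝ)) • triangularVec₁ a + ((ij.2 : ℝ)) • triangularVec₂ a +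
        (θ + ((i₀ : ℝ) • triangularVec₁ a + (j₀ : ℝ) • triangularVec₂ a)) + H • layerNormal 1‖) =
      ∑' ij : ℤ × ℤ, V ‖((ij.1 : ℝ)) • triangularVec₁ a + ((ij.2 : ℝ)) • triangularVec₂ a + θ + H • layerNormal 1‖ := by
  have h : ∀ ij : ℤ × ℤ, V ‖((ij.1 : ℝ)) • triangularVec₁ a + ((ij.2 : ℝ)) • triangularVec₂ a +
        (θ + ((i₀ : ℝ) • triangularVec₁ a + (j₀ : ℝ) • triangularVec₂ a)) + H • layerNormal 1‖ =
      (fun ij : ℤ × ℤ => V ‖((ij.1 : ℝ)) • triangularVec₁ a + ((ij.2 : ℝ)) • triangularVec₂ a + θ + H • layerNormal 1‖)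
        (Equiv.addRight ((i₀, j₀) : ℤ × ℤ) ij) := by
    intro ij
    simp only [Equiv.coe_addRight, Prod.fst_add, Prod.snd_add, Int.cast_add]
    congr 2
    module
  rw [tsum_congr h]
  exact Equiv.tsum_eq (Equiv.addRight ((i₀, j₀) : ℤ × ℤ))
    (fun ij : ℤ × ℤ => V ‖((ij.1 : ℝ)) • triangularVec₁ a + ((ij.2 : ℝ)) • triangularVec₂ a + θ + H • layerNormal 1‖)

/-- **Rotation invariance about a hollow site**: for a norm-preserving additive map `T` of `ℝ³` acting on the layer lattice as
the rotation by `2π/3` (`T v₁ = v₂ - v₁`, `T v₂ = -v₁`) and fixing `e₃`, the layer interaction is invariant under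
`θ ↦ T (θ - b) + b`, `b = (v₁ + v₂)/3` the hollow site: the lattice sum is re-indexed by `(i, j) ↦ (j, -i - j - 1)`. [folklore] -/
theorem gs_offsetLayer_rotate_hollow : ∀ (V : ℝ → ℝ) (a H : ℝ) (T : EuclideanSpace ℝ (Fin 3) →+ EuclideanSpace ℝ (Fin 3))
    (hT : ∀ w, ‖T w‖ = ‖w‖) (hTu : T (triangularVec₁ a) = triangularVec₂ a - triangularVec₁ a)
    (hTv : T (triangularVec₂ a) = -triangularVec₁ a) (hTe : T (layerNormal 1) = layerNormal 1)
    (hTs : ∀ (c : ℝ) (w : EuclideanSpace ℝ (Fin 3)), T (c • w) = c • T w) (θ : EuclideanSpace ℝ (Fin 3)),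
    (∑' ij : ℤ × ℤ, V ‖((ij.1 : ℝ)) • triangularVec₁ a + ((ij.2 : ℝ)) • triangularVec₂ a +
        (T (θ - (1 / 3 : ℝ) • (triangularVec₁ a + triangularVec₂ a)) + (1 / 3 : ℝ) • (triangularVec₁ a + triangularVec₂ a)) +
        H • layerNormal 1‖) =
      ∑' ij : ℤ × ℤ, V ‖((ij.1 : ℝ)) • triangularVec₁ a + ((ij.2 : ℝ)) • triangularVec₂ a + θ + H • layerNormal 1‖ := by
  intro V a H T hT hTu hTv hTe hTs θ
  -- the re-indexing equivalence `(i, j) ↦ (-i-j-1, i)` with inverse `(i, j) ↦ (j, -i-j-1)`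
  set e : ℤ × ℤ ≃ ℤ × ℤ := ⟨fun ij => (-ij.1 - ij.2 - 1, ij.1), fun ij => (ij.2, -ij.1 - ij.2 - 1),
    fun ij => Prod.ext (by simp) (by simp only; ring), fun ij => Prod.ext (by simp only; ring) (by simp)⟩ with he
  rw [← Equiv.tsum_eq e]
  refine tsum_congr fun ij => ?_
  obtain ⟨i, j⟩ := ij
  simp only [he, Equiv.coe_fn_mk, Int.cast_sub, Int.cast_neg, Int.cast_one]
  -- key identity: the re-indexed vector is `T` of the original one; `T` preserves norms
  have key : T (((i : ℝ)) • triangularVec₁ a + ((j : ℝ)) • triangularVec₂ a + θ + H • layerNormal 1) =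
      (-(i : ℝ) - j - 1) • triangularVec₁ a + ((i : ℝ)) • triangularVec₂ a +
        (T (θ - (1 / 3 : ℝ) • (triangularVec₁ a + triangularVec₂ a)) + (1 / 3 : ℝ) • (triangularVec₁ a + triangularVec₂ a)) +
        H • layerNormal 1 := by
    simp only [map_add, map_sub, hTs, hTu, hTv, hTe, smul_add, smul_sub]
    module
  rw [← key, hT]

end Summit.AtomisticToContinuum.Crystallization.Theorems.PeriodicWindowsDenseLaminarHull

end
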